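import Summits.HodgeConjecture.FermatCycles.ConditionQObstruction
import Summits.HodgeConjecture.FermatCycles.ShiodaConditionFourfold
import Literature.AlgebraicGeometry.HodgeTheory.FermatFourfoldFiveStandardSextuples
import Summits.HodgeConjecture.FermatCycles.ConditionQObstructionThirtyFiveA
import Summits.HodgeConjecture.FermatCycles.ConditionQObstructionThirtyFiveB
import HarnessLib

/-!
# Shioda's stable-generation condition `(Q⁴ₘ)` FAILS at `m = 35` — kernel certificate by an additive obstruction (part C of 3)

HONEST FRAMING: explicit algebraic cycles for specific Hodge classes on Fermat/Delsarte varieties;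
residual open instances listed; no claim on general Hodge.

Topic path `Summits/HodgeConjecture/FermatCycles/` of cell `pub-hfermat` (new work, not literature: a kernel certificate of a FALSE entry of the cell's
table `pub-hfermat-enum/P4-TABLE.md` §(Q⁴ₘ)). Framework: `ConditionQObstruction.lean` (`phi`, `pairsB`, `checkFour`, `checkSixRange`,
`not_conditionQ_four_of_obstruction`) — the printed argument of [Shioda1981FermatType] (Appendix, `m = 25`) with a general additive invariant.

THE CERTIFICATE at `m = 35`: the functional `Φ(s) = Σ_{x ∈ s} c(x)` with `c(15) = -1`, `c(20) = 1` (all other `c(x) = 0`; found by `code/lit/q4/sepfunc.py` as a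
vector of the rational null space of the generator matrix — `272` generators: `17` pairs, `153` Hodge `4`-multisets, `102` semi-decomposable Hodge sextuples)
is odd, vanishes on every Hodge `4`-multiset and on every semi-decomposable Hodge sextuple over `ℤ/35` (kernel enumerations below), hence on
`M'_35`; and `Φ(s) = -1` on the Hodge sextuple `s = (1, 8, 15, 22, 29, 30)`. So `s` is not `ξ₁ − ξ₂` with `ξᵢ ∈ M'_35`:
* part C of 3: `pairsB`, `checkFour` (42875 iterations), `phi_obs_thirtyFive` and **`not_conditionQ_thirtyFive_four : ¬ Shioda1979.ConditionQ 35 4`** (+ `not_conditionQAll_thirtyFive`, `not_conditionP_thirtyFive_four`, `not_conditionPAll_thirtyFive`, `not_shiodaConditionUpTo_thirtyFive_four'` by `(P) ⇒ (Q)`).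

PRINT STATUS (lit seat, 2026-08-20). `35 = 5·7`: the failing class is Aoki's `5`-standard element `σ₅ = (1,8,15,22,29,30)`, algebraic by [Aoki1987, Thm 2-1]; `(P⁴₃₅)` false is the tree's `FermatCharacter.not_shiodaConditionUpTo_thirtyfive_four`; `(Q⁴₃₅)` false is the cell's entry (P4-TABLE; the exact analogue of Shioda 1981's `m = 25`). HC(Xⁿ₃₅) ∀ n is one of the cell's residual questions (`ξ₃₅`, CANCEL-35) — untouched here.

References: [Shioda1979HodgeFermat] T. Shioda, Math. Ann. 245 (1979) §4 pp. 183–184 (`M'ₘ`, `(Qⁿₘ)`); [Shioda1981FermatType] T. Shioda,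
Math. Ann. 258 (1981), Appendix pp. 78–79; [Shioda1979PJA] T. Shioda, Proc. Japan Acad. 55A (1979) §1; [daSilva2021HodgeFermat] G. da Silva Jr.,
Experimental Results 2 (2021) e22; [Aoki1987] N. Aoki, J. Math. Soc. Japan 39 (1987); [Aoki2000FermatTypeRemarks] N. Aoki, Comment. Math.
Univ. St. Pauli 49 (2000); [Jumagulov2026OddFermatFourfolds] R. Jumagulov, arXiv:2608.18134 (preprint). Cell: P4-TABLE.md, data/shioda_Q4_m3-100.json,
code/lit/q4/sepfunc.py (this seat).
-/

namespace Summit.HodgeConjecture.FermatCycles.ConditionQObstruction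

open Multiset
open Literature.AlgebraicGeometry.HodgeTheory Literature.AlgebraicGeometry.HodgeTheory.FermatCharacter
open Literature.AlgebraicGeometry.Shioda1979 Literature.AlgebraicGeometry.Shioda1982
open Summit.HodgeConjecture.FermatCycles.ShiodaConditionFourfold

/-! ### Level `35` — part C; the functional `c` is written out in every statement (theorem-only files) -/

/-- `c` is odd: `Φ_c` kills the pairs. [cite: Shioda1979HodgeFermat, §3 p. 180 (Mₘ(1))] -/
theorem pairsB_35 :
    pairsB 35
      ([0, 0, 0, 0, 0, 0, 0, 0, 0, 0, 0, 0, 0, 0, 0, -1, 0, 0, 0, 0, 1, 0, 0, 0, 0, 0, 0, 0, 0, 0, 0, 0, 0, 0, 0] : List ℤ) = true := by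
  decide

set_option maxHeartbeats 0 in
/-- `Φ_c` vanishes on every Hodge `4`-multiset over `ℤ/35` (42875 loop iterations). Kernel. [cite: Shioda1979HodgeFermat, §4 p. 183 (Mₘ(2) ⊂ M'ₘ)] -/
theorem checkFour_35 :
    checkFour 35
      ([0, 0, 0, 0, 0, 0, 0, 0, 0, 0, 0, 0, 0, 0, 0, -1, 0, 0, 0, 0, 1, 0, 0, 0, 0, 0, 0, 0, 0, 0, 0, 0, 0, 0, 0] : List ℤ) = true := by
  decide +kernel

/-! `s = σ₅ = (1, 8, 15, 22, 29, 30)` is a Hodge sextuple over `ℤ/35`: the tree's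
`FermatCharacter.isHodgeMultiset_fiveStandard_thirtyfive` (`HodgeTheory/FermatFourfoldFiveStandardSextuples.lean`), used below. -/

/-- `Φ_c(s) = -1 ≠ 0`. [folklore] -/
theorem phi_obs_thirtyFive :
    phi 35
      ([0, 0, 0, 0, 0, 0, 0, 0, 0, 0, 0, 0, 0, 0, 0, -1, 0, 0, 0, 0, 1, 0, 0, 0, 0, 0, 0, 0, 0, 0, 0, 0, 0, 0, 0] : List ℤ)
      ({1, 8, 15, 22, 29, 30} : Multiset (ZMod 35)) ≠ 0 := by
  decide

/-- **`(Q⁴ₘ)` fails at `m = 35`**: the Hodge sextuple `s = (1, 8, 15, 22, 29, 30)` is not `ξ₁ − ξ₂` with `ξ₁, ξ₂ ∈ M'_35` — Shioda's 1979 method, even in its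
stable form, does not reach the class of `s` on `X⁴_35`. Kernel certificate of the cell's P4-TABLE entry `(Q⁴_35)` FALSE.
[cite: Shioda1979HodgeFermat, §4 condition (Qⁿₘ), pp. 183–184] -/
theorem not_conditionQ_thirtyFive_four : ¬ ConditionQ 35 4 :=
  not_conditionQ_four_of_obstruction pairsB_35 checkFour_35 [(0, 2), (2, 3), (5, 5), (10, 25)]
    (by
      intro a hN
      rcases Nat.lt_or_ge a 2 with h0 | h0
      · exact ⟨(0, 2), by simp, by omega, by omega⟩
      rcases Nat.lt_or_ge a 5 with h1 | h1
      · exact ⟨(2, 3), by simp, by omega, by omega⟩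
      rcases Nat.lt_or_ge a 10 with h2 | h2
      · exact ⟨(5, 5), by simp, by omega, by omega⟩
      exact ⟨(10, 25), by simp, by omega, by omega⟩
    )
    (by
      intro p hp
      simp only [List.mem_cons, List.not_mem_nil, or_false] at hp
      rcases hp with rfl | rfl | rfl | rfl
      · exact checkSix_35_0
      · exact checkSix_35_2
      · exact checkSix_35_5
      · exact checkSix_35_10
    )
    ({1, 8, 15, 22, 29, 30} : Multiset (ZMod 35)) isHodgeMultiset_fiveStandard_thirtyfive (by decide) phi_obs_thirtyFive

/-- Hence `(Q_35)` (all lengths) fails. [cite: Shioda1979HodgeFermat, §4 condition (Qₘ), p. 183] -/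
theorem not_conditionQAll_thirtyFive : ¬ ConditionQAll 35 := fun h ↦
  not_conditionQ_thirtyFive_four (conditionQAll_iff_forall.1 h 4)

/-- By `(P) ⇒ (Q)` the Math. Ann. condition `(P⁴_35)` fails. [cite: Shioda1979HodgeFermat, §3 p. 180, §4 p. 183] -/
theorem not_conditionP_thirtyFive_four_of_obstruction : ¬ ConditionP 35 4 := fun h ↦
  not_conditionQ_thirtyFive_four (conditionQ_of_conditionP h)

/-! The Proc. Japan Acad. form `¬ ShiodaConditionUpTo 35 4` is already in the tree (`FermatCharacter.not_shiodaConditionUpTo_thirtyfive_four`, Literature/AlgebraicGeometry/HodgeTheory/FermatFourfoldFiveStandardSextuples.lean); it also follows from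
`not_conditionQ_thirtyFive_four` by `Shioda1979.conditionQ_of_shiodaConditionUpTo` — not restated. -/

end Summit.HodgeConjecture.FermatCycles.ConditionQObstruction
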